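import Mathlib
import Summits.KontsevichZagierPeriods.Zeta5Search.BrickDigitStrip

/-!
# BrickDigitStripCarry — the offset families of the digit-stripping factorisation WITH CARRIES: the gained
members `y_a = N+J+1` (carry `n₀ + j₀ ≥ p`), `y_b = 2N−J+1` (carry `2n₀ − j₀ ≥ p`) and the centre member
`y_c = (n−2j)/(2p)` (`p ∣ n − 2j`) of zi-p2's THEOREM 7 LEMMA 2 for the ° cells (cell zeta5-irr)

HONEST FRAMING: systematic search; no irrationality claim unless certified. INSTRUMENT lemma of the ζ(5)
census cell zeta5-irr (HOME `run/shared/lean/pub/zeta5-irr/`; memo `zi-p2/probes/B8/thm7/THEOREM7.md` §2 LEMMA 1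
«MEMBER SETS … 𝓐_K = (K′, K′+N′+c_a] … 𝓑_K = (N′−K′−c_h, 2N′−K′+δ_b] … centre: y_c = (N−2K)/(2p) iff c_c = 1» and
LEMMA 2 (i) «𝓐_K = 𝓐̃ ⊔ {y_a if c_a}; 𝓑_K = 𝓑̃ ⊔ … ⊔ {y_b if δ_b = 1}»; design note HOME
`zi-eng/lean-g8/DESIGN-LEMMA2-TYPES.md` (F1)–(F3)). Nothing here is about ζ(5); no irrationality content; filing moves
no rung. Filed by the engine seat zi-eng (g9); sequel of `BrickDigitStrip` (zi-eng g8: the MAIN case `n₀ + j₀ < p`,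
`n₀ + (n₀ − j₀) < p`, `p ∤ n − 2j`, whose proofs are copied here with the index range as the only change).

## The statement

`p` prime, `n = n₀ + N·p`, `j = j₀ + J·p` with `j₀ ≤ n₀ < p` (a ° cell: the bottom digit of `j` does not exceed that
of `n`). The carries are COUNTED by `(n₀ + j₀)/p ∈ {0,1}` and `(n₀ + (n₀ − j₀))/p ∈ {0,1}` (natural division):

* `num_family_one_carry`: `∏_{m=1}^{n}(pX − (j+m)) = C(c)·[∏_{t=1}^{N + (n₀+j₀)/p}(X − (J+t))]·V` (`j + m = p(J+t) ↔
  m = tp − j₀`, now `t ≤ N + (n₀+j₀)/p`), `V` a unit polynomial (`BrickDigitStrip.IsUnitPoly`), `c ≠ 0`;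
* `num_family_two_carry` (`J ≤ N`): `∏_{m=1}^{n}(pX + (n+m−j)) = C(c)·[∏_{t=1}^{N + (2n₀−j₀)/p}(X + (N+t−J))]·V`;
* `prod_Icc_add_of_le_one`: `∏_{t=1}^{N+c} f t = (∏_{t=1}^{N} f t)·(f (N+1))^c` for `c ≤ 1` — splitting off the
  gained member `y_a = N+J+1` resp. `y_b = 2N−J+1` (`t = N+1`);
* `centre_factor_div`: `(pX + (n/2 − j))^ε = C(p^ε)·(X + (n/2−j)/p)^ε` (always), and `padicValuation_centre_le`:
  `(n/2 − j)/p ∈ ℤ_(p)` when `p ∣ n − 2j` (odd `p`); `div_two_carry_le_one`: the carries are `≤ 1`.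
The denominators need no change (`BrickDigitStrip.den_family` already covers every ° cell).
-/

namespace Summit.KontsevichZagierPeriods.Zeta5Search.BrickDigitStripCarry

open Finset Nat Polynomial WithZero
open Summit.KontsevichZagierPeriods.Zeta5Search.BrickDigitStrip (prod_split IsUnitPoly prod_unit_eq prod_div_eq
  padicValuation_intCast_eq_one_of)
open Literature.NumberTheory.LFunctions (padicValuation_natCast_eq_one)

noncomputable section

variable {p : ℕ} [Fact p.Prime]

/-! ## Small arithmetic -/

omit [Fact p.Prime] in
/-- A bottom-digit carry is `0` or `1`: `(a + b)/p ≤ 1` for `a, b < p`. -/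
theorem div_two_carry_le_one {a b : ℕ} (ha : a < p) (hb : b < p) : (a + b) / p ≤ 1 := by
  have hp : 0 < p := by omega
  exact Nat.lt_succ_iff.1 ((Nat.div_lt_iff_lt_mul hp).2 (by omega))

omit [Fact p.Prime] in
/-- Splitting off the gained member: `∏_{t=1}^{N+c} f t = (∏_{t=1}^{N} f t)·(f (N+1))^c` for `c ≤ 1`. -/
theorem prod_Icc_add_of_le_one {R : Type*} [CommMonoid R] (f : ℕ → R) (N : ℕ) {c : ℕ} (hc : c ≤ 1) :
    ∏ t ∈ Icc 1 (N + c), f t = (∏ t ∈ Icc 1 N, f t) * f (N + 1) ^ c := by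
  interval_cases c
  · rw [add_zero, pow_zero, mul_one]
  · rw [pow_one, Finset.prod_Icc_succ_top (by omega)]

/-! ## The two numerator families with carries -/

section families

variable {N n₀ J j₀ : ℕ} (hn₀ : n₀ < p) (hj₀ : j₀ ≤ n₀)
include hn₀ hj₀

/-- NUMERATORS I with carry (`x = −(j+m)`, `1 ≤ m ≤ n`): `∏_m(pX − (j+m)) = C(c)·[∏_{t=1}^{N+(n₀+j₀)/p}(X − (J+t))]·V`
for every ° cell (`j₀ ≤ n₀ < p`; the member `t = N+1`, i.e. `y_a = N+J+1`, is present iff `n₀ + j₀ ≥ p`). -/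
theorem num_family_one_carry (N J : ℕ) :
    ∃ V : ℚ[X], IsUnitPoly p V ∧ ∃ c : ℚ, c ≠ 0 ∧
      ∏ m ∈ Icc 1 (n₀ + N * p), (C (p : ℚ) * X + C (-(((j₀ + J * p : ℕ) : ℚ) + m))) =
        C c * (∏ t ∈ Icc 1 (N + (n₀ + j₀) / p), (X + C (-((J : ℚ) + t)))) * V := by
  have hp : p.Prime := Fact.out
  have hp0 : 0 < p := hp.pos
  have hca : (n₀ + j₀) / p * p ≤ n₀ + j₀ := Nat.div_mul_le_self _ _
  have hca' : n₀ + j₀ < (n₀ + j₀) / p * p + p := Nat.lt_div_mul_add hp0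
  have hg : ∀ t ∈ Icc 1 (N + (n₀ + j₀) / p), t * p - j₀ ∈ Icc 1 (n₀ + N * p) ∧ p ∣ (j₀ + J * p) + (t * p - j₀) := by
    intro t ht
    have ht' := mem_Icc.1 ht
    have hlo : p ≤ t * p := Nat.le_mul_of_pos_left p (by omega)
    have hhi : t * p ≤ (N + (n₀ + j₀) / p) * p := Nat.mul_le_mul_right _ ht'.2
    have hhi' : (N + (n₀ + j₀) / p) * p = N * p + (n₀ + j₀) / p * p := by ring
    refine ⟨mem_Icc.2 ⟨by omega, by omega⟩, ⟨J + t, ?_⟩⟩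
    have : p * (J + t) = J * p + t * p := by ring
    omega
  have hinj : Set.InjOn (fun t => t * p - j₀) (Icc 1 (N + (n₀ + j₀) / p) : Finset ℕ) := by
    intro t₁ ht₁ t₂ ht₂ h
    have h₁ : p ≤ t₁ * p := Nat.le_mul_of_pos_left p (by have := (mem_Icc.1 ht₁).1; omega)
    have h₂ : p ≤ t₂ * p := Nat.le_mul_of_pos_left p (by have := (mem_Icc.1 ht₂).1; omega)
    exact Nat.eq_of_mul_eq_mul_right hp0 (by simp only at h; omega)
  have hsurj : ∀ m ∈ Icc 1 (n₀ + N * p), p ∣ (j₀ + J * p) + m → ∃ t ∈ Icc 1 (N + (n₀ + j₀) / p), t * p - j₀ = m := by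
    intro m hm hdvd
    have hm' := mem_Icc.1 hm
    obtain ⟨q, hq⟩ := hdvd
    rw [mul_comm p q] at hq
    have hJq : J < q := by
      by_contra hcon
      have := Nat.mul_le_mul_right p (not_lt.1 hcon)
      omega
    have hqN : q ≤ J + N + (n₀ + j₀) / p := by
      by_contra hcon
      have h2 := Nat.mul_le_mul_right p (show J + N + (n₀ + j₀) / p + 1 ≤ q by omega)
      have h3 : (J + N + (n₀ + j₀) / p + 1) * p = J * p + N * p + ((n₀ + j₀) / p * p + p) := by ring
      omega
    have hsub : (q - J) * p = q * p - J * p := Nat.sub_mul q J p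
    refine ⟨q - J, mem_Icc.2 ⟨by omega, by omega⟩, ?_⟩
    show (q - J) * p - j₀ = m
    omega
  rw [prod_split (fun t => t * p - j₀) (fun m => p ∣ (j₀ + J * p) + m) hg hinj hsurj]
  have hdivpart : ∏ t ∈ Icc 1 (N + (n₀ + j₀) / p),
      (C (p : ℚ) * X + C (-(((j₀ + J * p : ℕ) : ℚ) + ((t * p - j₀ : ℕ) : ℚ)))) =
      C ((p : ℚ) ^ (Icc 1 (N + (n₀ + j₀) / p)).card) * ∏ t ∈ Icc 1 (N + (n₀ + j₀) / p), (X + C (-((J : ℚ) + t))) := by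
    rw [← prod_div_eq]
    refine prod_congr rfl fun t ht => ?_
    have hlo : j₀ ≤ t * p := (Nat.le_mul_of_pos_left p (by have := (mem_Icc.1 ht).1; omega)).trans' (by omega)
    congr 2; push_cast [hlo]; ring
  have hunit : ∀ m ∈ (Icc 1 (n₀ + N * p)).filter (fun m => ¬ p ∣ (j₀ + J * p) + m),
      Rat.padicValuation p (-(((j₀ + J * p : ℕ) : ℚ) + m)) = 1 := by
    intro m hm
    rw [Valuation.map_neg, ← Nat.cast_add]
    exact padicValuation_natCast_eq_one (mem_filter.1 hm).2
  obtain ⟨V, hV, hc, hVeq⟩ := prod_unit_eq hunit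
  refine ⟨V, hV, _, mul_ne_zero (pow_ne_zero ((Icc 1 (N + (n₀ + j₀) / p)).card)
    (by exact_mod_cast hp.ne_zero : (p : ℚ) ≠ 0)) hc, ?_⟩
  rw [hdivpart, hVeq, map_mul]
  ring

/-- NUMERATORS II with carry (`x = n+m−j`, `1 ≤ m ≤ n`): `∏_m(pX + (n+m−j)) = C(c)·[∏_{t=1}^{N+(2n₀−j₀)/p}(X + (N+t−J))]·V`
for every ° cell with `J ≤ N` (the member `t = N+1`, i.e. `y_b = 2N−J+1`, is present iff `2n₀ − j₀ ≥ p`). -/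
theorem num_family_two_carry {N J : ℕ} (hJN : J ≤ N) :
    ∃ V : ℚ[X], IsUnitPoly p V ∧ ∃ c : ℚ, c ≠ 0 ∧
      ∏ m ∈ Icc 1 (n₀ + N * p), (C (p : ℚ) * X + C (((n₀ + N * p : ℕ) : ℚ) + m - (j₀ + J * p : ℕ))) =
        C c * (∏ t ∈ Icc 1 (N + (n₀ + (n₀ - j₀)) / p), (X + C ((N : ℚ) + t - J))) * V := by
  have hp : p.Prime := Fact.out
  have hp0 : 0 < p := hp.pos
  have hJp : J * p ≤ N * p := Nat.mul_le_mul_right _ hJN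
  have hcb : (n₀ + (n₀ - j₀)) / p * p ≤ n₀ + (n₀ - j₀) := Nat.div_mul_le_self _ _
  have hcb' : n₀ + (n₀ - j₀) < (n₀ + (n₀ - j₀)) / p * p + p := Nat.lt_div_mul_add hp0
  have hg : ∀ t ∈ Icc 1 (N + (n₀ + (n₀ - j₀)) / p), t * p - (n₀ - j₀) ∈ Icc 1 (n₀ + N * p) ∧
      p ∣ (n₀ + N * p) + (t * p - (n₀ - j₀)) - (j₀ + J * p) := by
    intro t ht
    have ht' := mem_Icc.1 ht
    have hlo : p ≤ t * p := Nat.le_mul_of_pos_left p (by omega)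
    have hhi : t * p ≤ (N + (n₀ + (n₀ - j₀)) / p) * p := Nat.mul_le_mul_right _ ht'.2
    have hhi' : (N + (n₀ + (n₀ - j₀)) / p) * p = N * p + (n₀ + (n₀ - j₀)) / p * p := by ring
    refine ⟨mem_Icc.2 ⟨by omega, by omega⟩, ⟨N + t - J, ?_⟩⟩
    have e1 : p * (N + t - J) = (N + t) * p - J * p := by rw [mul_comm, Nat.sub_mul]
    have e2 : (N + t) * p = N * p + t * p := by ring
    omega
  have hinj : Set.InjOn (fun t => t * p - (n₀ - j₀)) (Icc 1 (N + (n₀ + (n₀ - j₀)) / p) : Finset ℕ) := by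
    intro t₁ ht₁ t₂ ht₂ h
    have h₁ : p ≤ t₁ * p := Nat.le_mul_of_pos_left p (by have := (mem_Icc.1 ht₁).1; omega)
    have h₂ : p ≤ t₂ * p := Nat.le_mul_of_pos_left p (by have := (mem_Icc.1 ht₂).1; omega)
    exact Nat.eq_of_mul_eq_mul_right hp0 (by simp only at h; omega)
  have hsurj : ∀ m ∈ Icc 1 (n₀ + N * p), p ∣ (n₀ + N * p) + m - (j₀ + J * p) →
      ∃ t ∈ Icc 1 (N + (n₀ + (n₀ - j₀)) / p), t * p - (n₀ - j₀) = m := by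
    intro m hm hdvd
    have hm' := mem_Icc.1 hm
    obtain ⟨q, hq⟩ := hdvd
    rw [mul_comm p q] at hq
    have hlo : N - J < q := by
      by_contra hcon
      have h3 := Nat.mul_le_mul_right p (not_lt.1 hcon)
      have h4 : (N - J) * p = N * p - J * p := Nat.sub_mul N J p
      omega
    have hhi : q ≤ 2 * N - J + (n₀ + (n₀ - j₀)) / p := by
      by_contra hcon
      have h3 := Nat.mul_le_mul_right p (show 2 * N - J + (n₀ + (n₀ - j₀)) / p + 1 ≤ q by omega)
      have h4 : (2 * N - J + (n₀ + (n₀ - j₀)) / p + 1) * p = 2 * (N * p) - J * p + ((n₀ + (n₀ - j₀)) / p * p + p) := by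
        rw [add_mul, add_mul, one_mul, Nat.sub_mul, mul_assoc, add_assoc]
      omega
    have hsub : (q - (N - J)) * p = q * p - (N * p - J * p) := by rw [Nat.sub_mul, Nat.sub_mul]
    refine ⟨q - (N - J), mem_Icc.2 ⟨by omega, by omega⟩, ?_⟩
    show (q - (N - J)) * p - (n₀ - j₀) = m
    omega
  rw [prod_split (fun t => t * p - (n₀ - j₀)) (fun m => p ∣ (n₀ + N * p) + m - (j₀ + J * p)) hg hinj hsurj]
  have hdivpart : ∏ t ∈ Icc 1 (N + (n₀ + (n₀ - j₀)) / p),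
      (C (p : ℚ) * X + C (((n₀ + N * p : ℕ) : ℚ) + ((t * p - (n₀ - j₀) : ℕ) : ℚ) - (j₀ + J * p : ℕ))) =
      C ((p : ℚ) ^ (Icc 1 (N + (n₀ + (n₀ - j₀)) / p)).card) *
        ∏ t ∈ Icc 1 (N + (n₀ + (n₀ - j₀)) / p), (X + C ((N : ℚ) + t - J)) := by
    rw [← prod_div_eq]
    refine prod_congr rfl fun t ht => ?_
    have hlo : n₀ - j₀ ≤ t * p := (Nat.le_mul_of_pos_left p (by have := (mem_Icc.1 ht).1; omega)).trans' (by omega)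
    congr 2; push_cast [hlo, hj₀]; ring
  have hunit : ∀ m ∈ (Icc 1 (n₀ + N * p)).filter (fun m => ¬ p ∣ (n₀ + N * p) + m - (j₀ + J * p)),
      Rat.padicValuation p (((n₀ + N * p : ℕ) : ℚ) + m - (j₀ + J * p : ℕ)) = 1 := by
    intro m hm
    have hle : j₀ + J * p ≤ n₀ + N * p + m := by omega
    rw [← Nat.cast_add, ← Nat.cast_sub hle]
    exact padicValuation_natCast_eq_one (mem_filter.1 hm).2
  obtain ⟨V, hV, hc, hVeq⟩ := prod_unit_eq hunit
  refine ⟨V, hV, _, mul_ne_zero (pow_ne_zero ((Icc 1 (N + (n₀ + (n₀ - j₀)) / p)).card)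
    (by exact_mod_cast hp.ne_zero : (p : ℚ) ≠ 0)) hc, ?_⟩
  rw [hdivpart, hVeq, map_mul]
  ring

end families

/-! ## The centre factor when `p ∣ n − 2j` -/

/-- THE CENTRE FACTOR, divisible case: `(pX + (n/2 − j))^ε = C(p^ε)·(X + y_c)^ε`, `y_c := (n/2 − j)/p = (n−2j)/(2p)`
(an identity for every `p ≠ 0`; useful when `p ∣ n − 2j`, where `y_c ∈ ℤ_(p)`). -/
theorem centre_factor_div (ε n j : ℕ) :
    (C (p : ℚ) * X + C ((n : ℚ) / 2 - j)) ^ ε = C ((p : ℚ) ^ ε) * (X + C (((n : ℚ) / 2 - j) / p)) ^ ε := by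
  have hp : p.Prime := Fact.out
  have hpQ : (p : ℚ) ≠ 0 := by exact_mod_cast hp.ne_zero
  rw [map_pow, ← mul_pow]
  congr 1
  rw [mul_add, ← C_mul, mul_div_cancel₀ _ hpQ]

/-- `y_c = (n/2 − j)/p` is a `p`-adic integer when `p ∣ n − 2j` (odd `p`). -/
theorem padicValuation_centre_le (hp2 : p ≠ 2) {n j : ℕ} (hdvd : (p : ℤ) ∣ (n : ℤ) - 2 * j) :
    Rat.padicValuation p (((n : ℚ) / 2 - j) / p) ≤ 1 := by
  have hp : p.Prime := Fact.out
  obtain ⟨q, hq⟩ := hdvd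
  have hpQ : (p : ℚ) ≠ 0 := by exact_mod_cast hp.ne_zero
  have htwo : Rat.padicValuation p (2 : ℚ) = 1 := by
    rw [show (2 : ℚ) = ((2 : ℤ) : ℚ) by norm_num]
    refine padicValuation_intCast_eq_one_of fun h => hp2 ?_
    exact (Nat.prime_dvd_prime_iff_eq hp Nat.prime_two).1 (by exact_mod_cast h)
  have e : ((n : ℚ) / 2 - j) / p = (q : ℚ) / 2 := by
    have : (n : ℚ) - 2 * j = (p : ℚ) * q := by exact_mod_cast hq
    field_simp
    linarith
  rw [e, map_div₀, htwo, div_one, Rat.padicValuation_cast]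
  exact Int.padicValuation_le_one _ _

/-- `y_c = (n/2 − j)/p ≠ 0` off the exact centre `2j ≠ n`. -/
theorem centre_ne_zero {n j : ℕ} (hcen : 2 * j ≠ n) : ((n : ℚ) / 2 - j) / p ≠ 0 := by
  have hp : p.Prime := Fact.out
  have hpQ : (p : ℚ) ≠ 0 := by exact_mod_cast hp.ne_zero
  refine div_ne_zero (fun h => hcen ?_) hpQ
  have : (2 * j : ℚ) = n := by linarith
  exact_mod_cast this

end

end Summit.KontsevichZagierPeriods.Zeta5Search.BrickDigitStripCarry
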